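import Literature.NumberTheory.Transcendental.RivoalSeriesAsymptotics
import Literature.NumberTheory.Transcendental.RivoalSeriesBounds
import Literature.NumberTheory.Transcendental.PeriodsWave0
import Literature.NumberTheory.DiophantineApproximation.NesterenkoCriterion
import Literature.NumberTheory.LFunctions.PrimeNumberTheoremErrorTermProofs
import HarnessLib

/-!
# Rivoal's linear forms in odd zeta values and the dimension bound for fixed `(a, r)`

Topic `Literature/NumberTheory/Transcendental`. Everything in this file is PROVED.

This is §3 ("Preuve du Théorème 1") of Rivoal (2000) up to, but not including, the final choice
of `r` as a function of `a`: for `a` odd, `r ≥ 1`, `2r + 2 ≤ a`, the integer linear forms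
`ℓ_m = 2 d_{n+1}^{a+1} S_n` (`n = 2m+2` even; `S_n` Rivoal's series, `d = lcm`) in
`1, ζ(3), ζ(5), …, ζ(a)` satisfy the hypotheses of Nesterenko's criterion with
`α = (e^{a+1} s)²` (`s = lim S_n^{1/n}`, `RivoalSeriesAsymptotics`) and
`β = (e^{a+1} κ)²`, `κ = 2^{a+1} (e(r+3))^{2r+1}` (`RivoalSeriesBounds` and the prime number
theorem `ψ(x) ∼ x` of the tree, `ChebyshevPsiDeLaValleePoussin_holds`), whence
(`finrank_span_ge`)

`dim_ℚ (ℚ + ℚζ(3) + ⋯ + ℚζ(a)) ≥ (a − 2r) log(r+1) / ((a+1)(1+log 2) + (2r+1)(1+log(r+3)))`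

provided `(a+1) + (2r+1)(1+log 2) < (a−2r) log(r+1)` (which makes `α < 1`).
(Rivoal uses `d_{2n}^a`; the tree's arithmetic lemma gives the slightly cruder denominator
`2 d_{n+1}^{a+1}`, which changes nothing in the limit `a → ∞`.)

## References

* T. Rivoal, C. R. Acad. Sci. Paris 331 (2000) 267–270, §3. [Rivoal2000]
* K. Ball, T. Rivoal, Invent. Math. 146 (2001) 193–207, Théorème 1. [BallRivoal2001]
-/

noncomputable section

open Finset Filter Real
open scoped Nat Topology

namespace Literature.NumberTheory.Transcendental

namespace RivoalSeries

open OddZeta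

/-! ### The prime number theorem for `d_n` -/

/-- `ψ(n)/n → 1` (from the tree's de la Vallée Poussin prime number theorem). [folklore] -/
theorem tendsto_psi_div : Tendsto (fun n : ℕ => Chebyshev.psi n / n) atTop (𝓝 1) := by
  obtain ⟨c, hc, C, hC⟩ := Literature.NumberTheory.LFunctions.ChebyshevPsiDeLaValleePoussin_holds
  have hE : Tendsto (fun n : ℕ => Real.exp (c * Real.sqrt (Real.log n))) atTop atTop := by
    refine Real.tendsto_exp_atTop.comp (Tendsto.const_mul_atTop hc ?_)
    have h1 : Tendsto (fun x : ℝ => x ^ (1 / 2 : ℝ)) atTop atTop := tendsto_rpow_atTop (by norm_num)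
    have h2 := h1.comp (Real.tendsto_log_atTop.comp tendsto_natCast_atTop_atTop)
    refine h2.congr fun n => ?_
    simp [Function.comp, Real.sqrt_eq_rpow]
  rw [Metric.tendsto_atTop]
  intro δ hδ
  obtain ⟨N, hN⟩ := eventually_atTop.1 (hE.eventually_ge_atTop ((max C 0 + 1) / (δ / 2)))
  refine ⟨max N 2, fun n hn => ?_⟩
  have hn2 : (2 : ℝ) ≤ n := by exact_mod_cast le_of_max_le_right hn
  have hn0 : (0 : ℝ) < n := by linarith
  have h1 := hC n hn2
  have h2 := hN n (le_of_max_le_left hn)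
  have hEpos : 0 < Real.exp (c * Real.sqrt (Real.log n)) := Real.exp_pos _
  rw [Real.dist_eq, show Chebyshev.psi n / n - 1 = (Chebyshev.psi n - n) / n by field_simp,
    abs_div, abs_of_pos hn0, div_lt_iff₀ hn0]
  have h3 : C * n / Real.exp (c * Real.sqrt (Real.log n)) ≤
      (max C 0 + 1) * n / Real.exp (c * Real.sqrt (Real.log n)) := by
    gcongr; linarith [le_max_left C 0]
  have h4 : (max C 0 + 1) * n / Real.exp (c * Real.sqrt (Real.log n)) ≤ δ / 2 * n := by
    rw [div_le_iff₀ hEpos]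
    rw [div_le_iff₀ (by positivity : (0 : ℝ) < δ / 2)] at h2
    have := mul_le_mul_of_nonneg_left h2 hn0.le
    nlinarith
  have h5 : δ / 2 * n < δ * n := by nlinarith
  linarith

/-- `d_n = exp(ψ(n))`. [folklore] -/
theorem dn_eq_exp_psi (n : ℕ) : dn n = Real.exp (Chebyshev.psi n) := by
  rw [Chebyshev.psi_eq_log_lcmUpto, Real.exp_log (by exact_mod_cast Nat.lcmUpto_pos n)]
  rfl

/-! ### Growth of the coefficient bound -/

/-- `C(M, n) ≤ (e M / n)^n` for `n ≥ 1`. [folklore] -/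
theorem choose_le_exp_pow {M n : ℕ} (hn : 1 ≤ n) :
    ((M.choose n : ℕ) : ℝ) ≤ (Real.exp 1 * M / n) ^ n := by
  have hn0 : (0 : ℝ) < n := by exact_mod_cast hn
  have h1 : ((M.choose n : ℕ) : ℝ) ≤ (M : ℝ) ^ n / n ! := Nat.choose_le_pow_div n M
  have h2 : (n : ℝ) ^ n / n ! ≤ Real.exp n := Real.pow_div_factorial_le_exp (n : ℝ) (by positivity) n
  have hfac : (0 : ℝ) < n ! := by exact_mod_cast Nat.factorial_pos n
  calc ((M.choose n : ℕ) : ℝ) ≤ (M : ℝ) ^ n / n ! := h1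
    _ = (M : ℝ) ^ n / (n : ℝ) ^ n * ((n : ℝ) ^ n / n !) := by field_simp
    _ ≤ (M : ℝ) ^ n / (n : ℝ) ^ n * Real.exp n :=
        mul_le_mul_of_nonneg_left h2 (by positivity)
    _ = (Real.exp 1 * M / n) ^ n := by
        rw [← Real.exp_one_pow, div_pow, mul_pow]; ring

/-- **Growth of `coeffBound`**: for `2r+1 ≤ a`, `n ≥ 1`,
`coeffBound a r n ≤ (r+1)((a+1)(a+2))^a · n (n+1)^{2a+1} · κ^n`,
`κ = 2^{a+1} (e(r+3))^{2r+1}`. [folklore] -/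
theorem coeffBound_le {a r n : ℕ} (ha : 2 * r + 1 ≤ a) (hn : 1 ≤ n) :
    coeffBound a r n ≤ ((r : ℝ) + 1) * (((a : ℝ) + 1) * ((a : ℝ) + 2)) ^ a * n *
      ((n : ℝ) + 1) ^ (2 * a + 1) *
      ((2 : ℝ) ^ (a + 1) * (Real.exp 1 * ((r : ℝ) + 3)) ^ (2 * r + 1)) ^ n := by
  have hn0 : (0 : ℝ) < n := by exact_mod_cast hn
  have hn1 : (1 : ℝ) ≤ n := by exact_mod_cast hn
  -- the binomial coefficient
  have hCb : (((r * n + 2 * n + 1).choose n : ℕ) : ℝ) ≤ (Real.exp 1 * ((r : ℝ) + 3)) ^ n := by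
    refine (choose_le_exp_pow (M := r * n + 2 * n + 1) hn).trans ?_
    refine pow_le_pow_left₀ (by positivity) ?_ n
    rw [div_le_iff₀ hn0]
    push_cast
    have : (0 : ℝ) < Real.exp 1 := Real.exp_pos 1
    nlinarith
  unfold coeffBound
  obtain ⟨p, hp⟩ : ∃ p, a = p + (2 * r + 1) := ⟨a - (2 * r + 1), by omega⟩
  have hp' : a - 2 * r - 1 = p := by omega
  rw [hp']
  set K : ℝ := Real.exp 1 * ((r : ℝ) + 3) with hK
  have hK0 : 0 ≤ K := by positivity
  have stepA : ((2 : ℝ) ^ n * (((r * n + 2 * n + 1).choose n : ℕ) : ℝ)) ^ (2 * r + 1) ≤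
      ((2 : ℝ) ^ n * K ^ n) ^ (2 * r + 1) := by
    gcongr
  have e2 : (2 : ℝ) ^ n * ((2 : ℝ) ^ n) ^ p * ((2 : ℝ) ^ n) ^ (2 * r + 1) = ((2 : ℝ) ^ (a + 1)) ^ n := by
    rw [← pow_succ', ← pow_add, ← pow_mul, ← pow_mul]
    congr 1
    rw [hp]; ring
  have stepB : ((n : ℝ) + 1) * ((2 : ℝ) ^ n * (n + r * n)) * ((2 : ℝ) ^ n) ^ p *
      ((2 : ℝ) ^ n * K ^ n) ^ (2 * r + 1) * (((n : ℝ) + 1) ^ 2 * ((a : ℝ) + 1) * ((a : ℝ) + 2)) ^ a =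
      ((r : ℝ) + 1) * (((a : ℝ) + 1) * ((a : ℝ) + 2)) ^ a * n * ((n : ℝ) + 1) ^ (2 * a + 1) *
        ((2 : ℝ) ^ (a + 1) * K ^ (2 * r + 1)) ^ n := by
    rw [mul_pow ((2 : ℝ) ^ (a + 1)) (K ^ (2 * r + 1)) n, ← e2]
    simp only [mul_pow, ← pow_mul]
    ring
  calc ((n : ℝ) + 1) * ((2 : ℝ) ^ n * (n + r * n)) * ((2 : ℝ) ^ n) ^ p *
        ((2 : ℝ) ^ n * (((r * n + 2 * n + 1).choose n : ℕ) : ℝ)) ^ (2 * r + 1) *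
        (((n : ℝ) + 1) ^ 2 * ((a : ℝ) + 1) * ((a : ℝ) + 2)) ^ a
      ≤ ((n : ℝ) + 1) * ((2 : ℝ) ^ n * (n + r * n)) * ((2 : ℝ) ^ n) ^ p *
        ((2 : ℝ) ^ n * K ^ n) ^ (2 * r + 1) *
        (((n : ℝ) + 1) ^ 2 * ((a : ℝ) + 1) * ((a : ℝ) + 2)) ^ a := by
        gcongr
    _ = _ := stepB

/-! ### `ζ(i) = ζ(i, 1)` and the reindexing of the odd zeta values -/

/-- `hz i 1 = zetaValue i` for `i ≥ 2` (shift the summation index by one; the `n = 0` term of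
`zetaValue` is Mathlib's junk value `0`). [folklore] -/
theorem hz_one_eq_zetaValue {i : ℕ} (hi : 2 ≤ i) : hz i 1 = zetaValue i := by
  unfold hz zetaValue
  have hsum : Summable (fun m : ℕ => 1 / (m : ℝ) ^ i) := Real.summable_one_div_nat_pow.mpr (by omega)
  rw [hsum.tsum_eq_zero_add]
  have h0 : (1 : ℝ) / (0 : ℕ) ^ i = 0 := by
    rw [Nat.cast_zero, zero_pow (by omega), div_zero]
  rw [h0, zero_add]
  refine tsum_congr fun m => ?_
  push_cast; ring_nf

/-- For `a = 2N+1`: the sum over `i ∈ [2, a+1]` of a function vanishing at even `i` is the sum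
over `i = 2j+3`, `j < N`. [folklore] -/
theorem sum_Icc_eq_sum_odd {N : ℕ} (f : ℕ → ℝ) (hf : ∀ i, Even i → f i = 0) :
    ∑ i ∈ Icc 2 (2 * N + 1 + 1), f i = ∑ j ∈ range N, f (2 * j + 3) := by
  induction N with
  | zero =>
    simp only [Nat.mul_zero, zero_add, range_zero, sum_empty]
    rw [show Icc 2 (1 + 1) = {2} by rfl, sum_singleton]
    exact hf 2 ⟨1, rfl⟩
  | succ N ih =>
    rw [sum_range_succ, ← ih]
    rw [show 2 * (N + 1) + 1 + 1 = (2 * N + 1 + 1) + 1 + 1 by ring,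
      Finset.sum_Icc_succ_top (by omega), Finset.sum_Icc_succ_top (by omega)]
    have he : f (2 * N + 1 + 1 + 1 + 1) = 0 := hf _ ⟨N + 2, by ring⟩
    rw [he, add_zero, show 2 * N + 1 + 1 + 1 = 2 * N + 3 by ring]

/-! ### Elementary limits along `n = 2m + 2` -/

/-- `(2m + c)/m → 2`. [folklore] -/
theorem tendsto_lin_div (c : ℝ) : Tendsto (fun m : ℕ => (2 * (m : ℝ) + c) / m) atTop (𝓝 2) := by
  have h2 : Tendsto (fun m : ℕ => 2 + c / (m : ℝ)) atTop (𝓝 (2 + 0)) :=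
    tendsto_const_nhds.add (tendsto_const_div_atTop_nhds_zero_nat c)
  rw [add_zero] at h2
  refine h2.congr' ?_
  filter_upwards [eventually_ge_atTop 1] with m hm
  have : (0 : ℝ) < m := by exact_mod_cast hm
  rw [add_div, mul_div_assoc, div_self this.ne', mul_one]

/-- `2m + c → ∞`. [folklore] -/
theorem tendsto_two_mul_add (c : ℕ) : Tendsto (fun m : ℕ => 2 * m + c) atTop atTop :=
  tendsto_atTop_mono (fun m => by simp only [id_eq]; omega) tendsto_id

/-- `ψ(2m+3)/m → 2` (prime number theorem). [folklore] -/
theorem tendsto_psi_shift_div :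
    Tendsto (fun m : ℕ => Chebyshev.psi ((2 * m + 3 : ℕ) : ℝ) / m) atTop (𝓝 2) := by
  have h1 := tendsto_psi_div.comp (tendsto_two_mul_add 3)
  have h2 := h1.mul (tendsto_lin_div 3)
  rw [one_mul] at h2
  refine h2.congr' ?_
  filter_upwards [eventually_ge_atTop 1] with m hm
  have hm0 : (0 : ℝ) < m := by exact_mod_cast hm
  have hx0 : (0 : ℝ) < 2 * m + 3 := by positivity
  simp only [Function.comp_apply]
  push_cast
  field_simp

/-- `log(2m+3)/m → 0`. [folklore] -/
theorem tendsto_log_shift_div :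
    Tendsto (fun m : ℕ => Real.log ((2 * m + 3 : ℕ) : ℝ) / m) atTop (𝓝 0) := by
  have h1 := (Real.isLittleO_log_id_atTop.tendsto_div_nhds_zero.comp
    (tendsto_natCast_atTop_atTop.comp (tendsto_two_mul_add 3))).mul (tendsto_lin_div 3)
  rw [zero_mul] at h1
  refine h1.congr' ?_
  filter_upwards [eventually_ge_atTop 1] with m hm
  have hm0 : (0 : ℝ) < m := by exact_mod_cast hm
  have hx0 : (0 : ℝ) < 2 * m + 3 := by positivity
  simp only [Function.comp_apply, id_eq]
  push_cast
  field_simp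

/-- `log S_{2m+2}/m → 2 log s` when `S_n^{1/n} → s > 0`. [folklore] -/
theorem tendsto_log_series_div {a r : ℕ} (ha : 2 * r + 2 ≤ a) {s : ℝ} (hs0 : 0 < s)
    (hstend : Tendsto (fun n : ℕ => series a r n ^ (1 / (n : ℝ))) atTop (𝓝 s)) :
    Tendsto (fun m : ℕ => Real.log (series a r (2 * m + 2)) / m) atTop (𝓝 (2 * Real.log s)) := by
  have h1 : Tendsto (fun n : ℕ => Real.log (series a r n) / n) atTop (𝓝 (Real.log s)) := by
    have h := (Real.continuousAt_log hs0.ne').tendsto.comp hstend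
    refine h.congr' ?_
    filter_upwards [eventually_ge_atTop 1] with n hn
    simp only [Function.comp_apply]
    rw [Real.log_rpow (series_pos a r n hn ha), one_div, inv_mul_eq_div]
  have h2 := (h1.comp (tendsto_two_mul_add 2)).mul (tendsto_lin_div 2)
  rw [mul_comm (Real.log s) 2] at h2
  refine h2.congr' ?_
  filter_upwards [eventually_ge_atTop 1] with m hm
  have hm0 : (0 : ℝ) < m := by exact_mod_cast hm
  have hx0 : (0 : ℝ) < 2 * m + 2 := by positivity
  simp only [Function.comp_apply]
  push_cast
  field_simp

/-! ### The linear forms at `n = 2m+2`, reindexed, with cleared denominators -/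

/-- The data of `linear_forms_bound` at `n = 2m+2`: integers `q₀, q_j` (`j < N`, `a = 2N+1`) with
`q₀ + ∑_{j<N} q_j ζ(2j+3) = 2 d_{n+1}^{a+1} S_n` and
`|q₀|, |q_j| ≤ 2 d_{n+1}^{a+1} (n+1)²(a+1) coeffBound a r n`. [cite: Rivoal2000, §3] -/
theorem exists_forms_at {a r N : ℕ} (haN : a = 2 * N + 1) (hr : 1 ≤ r) (ha : 2 * r + 2 ≤ a)
    (m : ℕ) :
    ∃ q : Fin (N + 1) → ℤ,
      (q 0 : ℝ) + ∑ j : Fin N, (q j.succ : ℝ) * zetaValue (2 * (j : ℕ) + 3) =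
        2 * dn (2 * m + 3) ^ (a + 1) * series a r (2 * m + 2) ∧
      ∀ j, |(q j : ℝ)| ≤ 2 * dn (2 * m + 3) ^ (a + 1) *
        ((((2 * m + 2 : ℕ) : ℝ) + 1) ^ 2 * ((a : ℝ) + 1) * coeffBound a r (2 * m + 2)) := by
  have hodd : Odd a := ⟨N, by omega⟩
  obtain ⟨ρ, ρ0, hρeven, hρZ, hρ0Z, hρB, hρ0B, hsum⟩ :=
    linear_forms_bound (a := a) (r := r) (n := 2 * m + 2) (by omega) ⟨m + 1, by ring⟩ hodd ha
  rw [show 2 * m + 2 + 1 = 2 * m + 3 by ring] at hρ0Z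
  set D : ℝ := 2 * dn (2 * m + 3) ^ (a + 1) with hD
  have hDpos : 0 < D := by rw [hD]; positivity [dn_pos (2 * m + 3)]
  -- integrality of `D ρ_i`
  have hint : ∀ i, i ≤ a + 1 → IsZ (D * ρ i) := by
    intro i hi
    have hdiv : IsZ (dn (2 * m + 3) / dn (2 * m + 2)) := isZ_dn_div_dn (by omega)
    have hd0 : dn (2 * m + 2) ≠ 0 := (dn_pos _).ne'
    have key : D * ρ i = (2 * dn (2 * m + 2) ^ (a + 1 - i) * ρ i) *
        (dn (2 * m + 3) / dn (2 * m + 2)) ^ (a + 1 - i) * dn (2 * m + 3) ^ i := by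
      rw [hD, show dn (2 * m + 3) ^ (a + 1) =
        dn (2 * m + 3) ^ (a + 1 - i) * dn (2 * m + 3) ^ i by
          rw [← pow_add]; congr 1; omega, div_pow]
      field_simp
    rw [key]
    exact ((hρZ i).mul (hdiv.pow _)).mul ((isZ_dn _).pow _)
  obtain ⟨z0, hz0⟩ := hρ0Z
  have hqj : ∀ j : Fin N, ∃ z : ℤ, D * ρ (2 * (j : ℕ) + 3) = z := fun j =>
    hint _ (by have := j.isLt; omega)
  choose zj hzj using hqj
  refine ⟨Fin.cons z0 zj, ?_, ?_⟩
  · -- the identity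
    simp only [Fin.cons_zero, Fin.cons_succ]
    have h1 : series a r (2 * m + 2) = ∑' k : ℕ, ratfun a r (2 * m + 2) ((k + 1 + 1 : ℕ) : ℝ) := by
      rw [series_eq, (summable_ratfun_succ a r (2 * m + 2) (by omega) ha).tsum_eq_zero_add]
      rw [ratfun_nat_eq_zero a r (2 * m + 2) (k := 0 + 1) (by omega) (by nlinarith), zero_add]
    have h2 : ∀ k : ℕ, ratfun a r (2 * m + 2) ((k + 1 + 1 : ℕ) : ℝ) =
        Rfun r 1 a (2 * m + 2) ((k : ℝ) + 1 + 1) := by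
      intro k
      rw [Rfun_one_eq_ratfun a r _ (by omega)]
      push_cast; ring_nf
    have hseries : series a r (2 * m + 2) =
        ρ0 + ∑ j ∈ range N, ρ (2 * j + 3) * zetaValue (2 * j + 3) := by
      rw [h1, tsum_congr h2, hsum.tsum_eq, haN, sum_Icc_eq_sum_odd _ (fun i hi => ?_)]
      · congr 1
        refine sum_congr rfl fun j _ => ?_
        rw [hz_one_eq_zetaValue (by omega)]
      · rw [hρeven i hi, zero_mul]
    rw [hseries, mul_add, mul_sum, ← hz0, Finset.sum_range]
    congr 1
    refine Finset.sum_congr rfl fun j _ => ?_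
    rw [← hzj j]; ring
  · -- the bounds
    have hC := coeffBound_nonneg a r (2 * m + 2)
    intro j
    refine Fin.cases ?_ (fun j => ?_) j
    · simp only [Fin.cons_zero]
      rw [← hz0, abs_mul, abs_of_pos hDpos]
      exact mul_le_mul_of_nonneg_left hρ0B hDpos.le
    · simp only [Fin.cons_succ]
      rw [← hzj j, abs_mul, abs_of_pos hDpos]
      refine mul_le_mul_of_nonneg_left ((hρB _).trans ?_) hDpos.le
      have h2 : (1 : ℝ) ≤ (((2 * m + 2 : ℕ) : ℝ) + 1) * ((a : ℝ) + 1) :=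
        one_le_mul_of_one_le_of_one_le (by linarith [(Nat.cast_nonneg (2 * m + 2) : (0 : ℝ) ≤ _)])
          (by linarith [(Nat.cast_nonneg a : (0 : ℝ) ≤ _)])
      have h3 : (0 : ℝ) ≤ (((2 * m + 2 : ℕ) : ℝ) + 1) * coeffBound a r (2 * m + 2) := by positivity
      nlinarith

/-- Growth of the cleared coefficients: with `κ = 2^{a+1}(e(r+3))^{2r+1}` and
`cst = 2(a+1)(r+1)((a+1)(a+2))^a`, for `m ≥ 1`,
`2 d_{2m+3}^{a+1} (2m+3)²(a+1) coeffBound a r (2m+2) ≤ exp(log cst + (2a+4) log(2m+3) + (a+1)ψ(2m+3) + (2m+2) log κ)`.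
[folklore] -/
theorem cleared_bound_le_exp {a r : ℕ} (ha : 2 * r + 2 ≤ a) (m : ℕ) :
    2 * dn (2 * m + 3) ^ (a + 1) *
        ((((2 * m + 2 : ℕ) : ℝ) + 1) ^ 2 * ((a : ℝ) + 1) * coeffBound a r (2 * m + 2)) ≤
      Real.exp (Real.log (2 * ((a : ℝ) + 1) * (((r : ℝ) + 1) * (((a : ℝ) + 1) * ((a : ℝ) + 2)) ^ a)) +
        (2 * a + 4) * Real.log ((2 * m + 3 : ℕ) : ℝ) +
        (a + 1) * Chebyshev.psi ((2 * m + 3 : ℕ) : ℝ) +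
        (2 * m + 2) * Real.log ((2 : ℝ) ^ (a + 1) * (Real.exp 1 * ((r : ℝ) + 3)) ^ (2 * r + 1))) := by
  set K : ℝ := Real.exp 1 * ((r : ℝ) + 3) with hK
  set κ : ℝ := (2 : ℝ) ^ (a + 1) * K ^ (2 * r + 1) with hκ
  set cst : ℝ := 2 * ((a : ℝ) + 1) * (((r : ℝ) + 1) * (((a : ℝ) + 1) * ((a : ℝ) + 2)) ^ a) with hcst
  have hκ0 : 0 < κ := by positivity
  have hcst0 : 0 < cst := by positivity
  have hn1 : 1 ≤ 2 * m + 2 := by omega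
  have h2 := coeffBound_le (a := a) (r := r) (n := 2 * m + 2) (by omega) hn1
  rw [← hK, ← hκ] at h2
  have hD : 2 * dn (2 * m + 3) ^ (a + 1) = 2 * Real.exp ((a + 1) * Chebyshev.psi ((2 * m + 3 : ℕ) : ℝ)) := by
    rw [dn_eq_exp_psi, ← Real.exp_nat_mul]; push_cast; ring_nf
  have hDpos : 0 < 2 * dn (2 * m + 3) ^ (a + 1) := by positivity [dn_pos (2 * m + 3)]
  have hx : (((2 * m + 2 : ℕ) : ℝ) + 1) = ((2 * m + 3 : ℕ) : ℝ) := by push_cast; ring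
  have hx0 : (0 : ℝ) < ((2 * m + 3 : ℕ) : ℝ) := by positivity
  have hx1 : ((2 * m + 2 : ℕ) : ℝ) ≤ ((2 * m + 3 : ℕ) : ℝ) := by push_cast; linarith
  calc 2 * dn (2 * m + 3) ^ (a + 1) *
        ((((2 * m + 2 : ℕ) : ℝ) + 1) ^ 2 * ((a : ℝ) + 1) * coeffBound a r (2 * m + 2))
      ≤ 2 * dn (2 * m + 3) ^ (a + 1) * ((((2 * m + 2 : ℕ) : ℝ) + 1) ^ 2 * ((a : ℝ) + 1) *
          (((r : ℝ) + 1) * (((a : ℝ) + 1) * ((a : ℝ) + 2)) ^ a * ((2 * m + 2 : ℕ) : ℝ) *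
            (((2 * m + 2 : ℕ) : ℝ) + 1) ^ (2 * a + 1) * κ ^ (2 * m + 2))) := by
        gcongr
    _ ≤ 2 * dn (2 * m + 3) ^ (a + 1) * ((((2 * m + 3 : ℕ) : ℝ)) ^ 2 * ((a : ℝ) + 1) *
          (((r : ℝ) + 1) * (((a : ℝ) + 1) * ((a : ℝ) + 2)) ^ a * ((2 * m + 3 : ℕ) : ℝ) *
            (((2 * m + 3 : ℕ) : ℝ)) ^ (2 * a + 1) * κ ^ (2 * m + 2))) := by
        rw [hx]
        gcongr
    _ = cst * (((2 * m + 3 : ℕ) : ℝ)) ^ (2 * a + 4) *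
          Real.exp ((a + 1) * Chebyshev.psi ((2 * m + 3 : ℕ) : ℝ)) * κ ^ (2 * m + 2) := by
        rw [hD, hcst]; ring
    _ = _ := by
        rw [Real.exp_add, Real.exp_add, Real.exp_add, Real.exp_log hcst0,
          show ((2 : ℝ) * a + 4) = ((2 * a + 4 : ℕ) : ℝ) by push_cast; ring, Real.exp_nat_mul,
          Real.exp_log hx0, show ((2 : ℝ) * m + 2) = ((2 * m + 2 : ℕ) : ℝ) by push_cast; ring,
          Real.exp_nat_mul, Real.exp_log hκ0]

/-! ### The dimension bound for fixed `(a, r)` -/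

/-- **Rivoal 2000, §3 for fixed `a`, `r`** (before the choice of `r = r(a)`): for `a` odd,
`1 ≤ r`, `2r + 2 ≤ a` and `(a+1) + (2r+1)(1+log 2) < (a−2r) log(r+1)`, the `ℚ`-span of
`1, ζ(3), ζ(5), …, ζ(a)` has dimension at least
`(a − 2r) log(r+1) / ((a+1)(1 + log 2) + (2r+1)(1 + log(r+3)))` — Nesterenko's criterion applied
to the integer forms `2 d_{n+1}^{a+1} S_n`, `n = 2m + 2`. [cite: Rivoal2000, §3] -/
theorem finrank_span_ge (a r : ℕ) (hodd : Odd a) (hr : 1 ≤ r) (ha : 2 * r + 2 ≤ a)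
    (hsmall : (a : ℝ) + 1 + (2 * r + 1) * (1 + Real.log 2) < ((a : ℝ) - 2 * r) * Real.log (r + 1)) :
    ((a : ℝ) - 2 * r) * Real.log (r + 1) /
        (((a : ℝ) + 1) * (1 + Real.log 2) + (2 * r + 1) * (1 + Real.log (r + 3))) ≤
      Module.finrank ℚ (Submodule.span ℚ (Set.range
        (Fin.cons (1 : ℝ) (fun j : Fin ((a - 1) / 2) => zetaValue (2 * (j : ℕ) + 3)) :
          Fin ((a - 1) / 2 + 1) → ℝ))) := by
  -- `a = 2N + 1`
  set N := (a - 1) / 2 with hN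
  have haN : a = 2 * N + 1 := by obtain ⟨k, hk⟩ := hodd; omega
  set θ : Fin (N + 1) → ℝ := Fin.cons (1 : ℝ) (fun j : Fin N => zetaValue (2 * (j : ℕ) + 3)) with hθ
  -- the integer forms
  have hforms := fun m => exists_forms_at (r := r) haN hr ha m
  choose p hpℓ hpb using hforms
  set Dn : ℕ → ℝ := fun m => 2 * dn (2 * m + 3) ^ (a + 1) with hDn
  have hDnpos : ∀ m, 0 < Dn m := fun m => by simp only [hDn]; positivity [dn_pos (2 * m + 3)]
  have hℓ : ∀ m, ∑ j, (p m j : ℝ) * θ j = Dn m * series a r (2 * m + 2) := by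
    intro m
    rw [Fin.sum_univ_succ, ← hpℓ m]
    simp only [hθ, Fin.cons_zero, Fin.cons_succ, mul_one]
  have hℓpos : ∀ m, 0 < ∑ j, (p m j : ℝ) * θ j := fun m => by
    rw [hℓ m]; exact mul_pos (hDnpos m) (series_pos a r _ (by omega) ha)
  -- the asymptotic data
  obtain ⟨s, hs0, hsle, hstend⟩ := tendsto_series_rpow a r ha
  set K : ℝ := Real.exp 1 * ((r : ℝ) + 3) with hK
  set κ : ℝ := (2 : ℝ) ^ (a + 1) * K ^ (2 * r + 1) with hκ
  have hK1 : 1 ≤ K := by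
    rw [hK]
    have : (1 : ℝ) ≤ Real.exp 1 := by linarith [Real.add_one_le_exp (1 : ℝ)]
    nlinarith
  have hκ1 : 1 ≤ κ := one_le_mul_of_one_le_of_one_le (one_le_pow₀ (by norm_num)) (one_le_pow₀ hK1)
  have hκ0 : 0 < κ := by linarith
  have hlogκ : Real.log κ = (a + 1) * Real.log 2 + (2 * r + 1) * (1 + Real.log (r + 3)) := by
    rw [hκ, Real.log_mul (by positivity) (by positivity), Real.log_pow, hK, Real.log_pow,
      Real.log_mul (Real.exp_pos 1).ne' (by positivity), Real.log_exp]
    push_cast; ring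
  set α : ℝ := (Real.exp (a + 1) * s) ^ 2 with hα
  set β : ℝ := (Real.exp (a + 1) * κ) ^ 2 with hβ
  have hα0 : 0 < α := by positivity
  have hlogα : Real.log α = 2 * ((a + 1) + Real.log s) := by
    rw [hα, Real.log_pow, Real.log_mul (Real.exp_pos _).ne' hs0.ne', Real.log_exp]; push_cast; ring
  have hlogβ : Real.log β = 2 * ((a + 1) + Real.log κ) := by
    rw [hβ, Real.log_pow, Real.log_mul (Real.exp_pos _).ne' hκ0.ne', Real.log_exp]; push_cast; ring
  have hlogs : Real.log s ≤ (2 * r + 1) * (1 + Real.log 2) - ((a : ℝ) - 2 * r) * Real.log (r + 1) := by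
    have := Real.log_le_log hs0 hsle
    rw [Real.log_div (Real.exp_pos _).ne' (by positivity), Real.log_exp, Real.log_pow,
      Nat.cast_sub (by omega)] at this
    push_cast at this
    linarith
  have hα1 : α < 1 := by
    have h1 : (a : ℝ) + 1 + Real.log s < 0 := by linarith
    have h2 : Real.exp (a + 1) * s < 1 := by
      have : Real.log (Real.exp (a + 1) * s) < 0 := by
        rw [Real.log_mul (Real.exp_pos _).ne' hs0.ne', Real.log_exp]; exact h1
      exact (Real.log_neg_iff (by positivity)).mp this
    exact pow_lt_one₀ (by positivity) h2 two_ne_zero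
  have hβ1 : 1 < β := by
    have he : 1 < Real.exp ((a : ℝ) + 1) := Real.one_lt_exp_iff.mpr (by positivity)
    have : 1 < Real.exp ((a : ℝ) + 1) * κ := by nlinarith
    exact one_lt_pow₀ this two_ne_zero
  -- growth of the coefficients
  set cst : ℝ := 2 * ((a : ℝ) + 1) * (((r : ℝ) + 1) * (((a : ℝ) + 1) * ((a : ℝ) + 2)) ^ a) with hcst
  set U : ℕ → ℝ := fun m => Real.log cst + (2 * a + 4) * Real.log ((2 * m + 3 : ℕ) : ℝ) +
      (a + 1) * Chebyshev.psi ((2 * m + 3 : ℕ) : ℝ) + (2 * m + 2) * Real.log κ with hU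
  have hpU : ∀ m (j : Fin (N + 1)), |(p m j : ℝ)| ≤ Real.exp (U m) := fun m j =>
    (hpb m j).trans (cleared_bound_le_exp ha m)
  have hUlim : Tendsto (fun m : ℕ => U m / m) atTop (𝓝 (Real.log β)) := by
    have h := ((tendsto_const_div_atTop_nhds_zero_nat (Real.log cst)).add
      ((tendsto_log_shift_div.const_mul (2 * (a : ℝ) + 4)))).add
      ((tendsto_psi_shift_div.const_mul ((a : ℝ) + 1)).add ((tendsto_lin_div 2).mul_const (Real.log κ)))
    rw [hlogβ]
    have e : (0 : ℝ) + (2 * (a : ℝ) + 4) * 0 + (((a : ℝ) + 1) * 2 + 2 * Real.log κ) =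
        2 * ((a : ℝ) + 1 + Real.log κ) := by ring
    rw [e] at h
    refine h.congr' ?_
    filter_upwards [eventually_ge_atTop 1] with m hm
    have hm0 : (0 : ℝ) < m := by exact_mod_cast hm
    simp only [hU]
    field_simp
    ring
  have hgrowth : ∀ β' : ℝ, β < β' → ∀ᶠ m : ℕ in atTop, ∀ j, |(p m j : ℝ)| ≤ β' ^ m := by
    intro β' hβ'
    have hβ'0 : 0 < β' := by linarith
    have hlt : Real.log β < Real.log β' := Real.log_lt_log (by linarith) hβ'
    filter_upwards [hUlim.eventually_lt_const hlt, eventually_ge_atTop 1] with m hm hm1 j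
    have hm0 : (0 : ℝ) < m := by exact_mod_cast hm1
    refine (hpU m j).trans ?_
    rw [div_lt_iff₀ hm0] at hm
    calc Real.exp (U m) ≤ Real.exp (Real.log β' * m) := Real.exp_le_exp.mpr hm.le
      _ = β' ^ m := by rw [mul_comm, Real.exp_nat_mul, Real.exp_log hβ'0]
  -- smallness: `|ℓ_m|^{1/m} → α`
  have hVlim : Tendsto (fun m : ℕ => Real.log (∑ j, (p m j : ℝ) * θ j) / m) atTop
      (𝓝 (Real.log α)) := by
    have h := ((tendsto_const_div_atTop_nhds_zero_nat (Real.log 2)).add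
      (tendsto_psi_shift_div.const_mul ((a : ℝ) + 1))).add (tendsto_log_series_div ha hs0 hstend)
    rw [hlogα]
    have e : (0 : ℝ) + ((a : ℝ) + 1) * 2 + 2 * Real.log s = 2 * ((a : ℝ) + 1 + Real.log s) := by ring
    rw [e] at h
    refine h.congr' ?_
    filter_upwards [eventually_ge_atTop 1] with m hm
    have hm0 : (0 : ℝ) < m := by exact_mod_cast hm
    rw [hℓ m]
    have hD : Dn m = 2 * Real.exp ((a + 1) * Chebyshev.psi ((2 * m + 3 : ℕ) : ℝ)) := by
      simp only [hDn]
      rw [dn_eq_exp_psi, ← Real.exp_nat_mul]; push_cast; ring_nf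
    rw [hD, Real.log_mul (by positivity) (series_pos a r _ (by omega) ha).ne',
      Real.log_mul two_ne_zero (Real.exp_pos _).ne', Real.log_exp]
    field_simp
  have hℓtend : Tendsto (fun m : ℕ => |∑ j, (p m j : ℝ) * θ j| ^ (1 / (m : ℝ))) atTop (𝓝 α) := by
    have h := (Real.continuous_exp.tendsto _).comp hVlim
    rw [Real.exp_log hα0] at h
    refine h.congr' ?_
    filter_upwards [eventually_ge_atTop 1] with m hm
    simp only [Function.comp_apply]
    rw [abs_of_pos (hℓpos m), Real.rpow_def_of_pos (hℓpos m), div_eq_mul_one_div]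
  -- Nesterenko's criterion
  have hcrit :=
    Literature.NumberTheory.DiophantineApproximation.NesterenkoCriterion.nesterenko_criterion
      θ p hα0 hα1 hβ1 hgrowth hℓtend
  refine le_trans ?_ hcrit
  -- `LB ≤ 1 - log α / log β`
  have hden : ((a : ℝ) + 1) * (1 + Real.log 2) + (2 * r + 1) * (1 + Real.log (r + 3)) =
      (a : ℝ) + 1 + Real.log κ := by rw [hlogκ]; ring
  have hdenpos : 0 < (a : ℝ) + 1 + Real.log κ := by
    have : 0 ≤ Real.log κ := Real.log_nonneg hκ1
    positivity
  have hlogβ0 : Real.log β ≠ 0 := (Real.log_pos hβ1).ne'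
  rw [hden, show 1 - Real.log α / Real.log β =
    (Real.log κ - Real.log s) / ((a : ℝ) + 1 + Real.log κ) by
      rw [hlogα, hlogβ]; field_simp; ring]
  refine div_le_div_of_nonneg_right ?_ hdenpos.le
  have h1 : 0 ≤ ((a : ℝ) - 2 * r) * Real.log 2 := by
    have : (2 : ℝ) * r ≤ a := by exact_mod_cast (show 2 * r ≤ a by omega)
    have := Real.log_pos one_lt_two
    nlinarith
  have h2 : 0 ≤ (2 * (r : ℝ) + 1) * Real.log (r + 3) := by
    have : 0 ≤ Real.log ((r : ℝ) + 3) := Real.log_nonneg (by linarith [(Nat.cast_nonneg r : (0:ℝ) ≤ r)])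
    positivity
  rw [hlogκ]
  linarith

end RivoalSeries

end Literature.NumberTheory.Transcendental
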